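import Mathlib
import Literature.Computability.Complexity.CliqueTestGraphs
import Literature.GroupTheory.PermutationGroups.SmallIndexSubgroups
import Summits.PneNP.PneNP.Theorems.ConvexRankGatesConvexGateBlindJuntaBlind
import Summits.PneNP.PneNP.Theorems.ConvexRankGatesConvexGateBlindExactLiftingEquivariant

/-!
# PneNP / ConvexRankGates — `ConvexGateBlind`: SYMMETRIC LP certificates are ε-exactly blind (unconditional)

Helpers (`--supports stmt-PneNP-10680`). The symmetric case of the LP slice of the crux, now WITHOUT any group-theoretic
hypothesis. `…JuntaBlind.lean` proved that junta certificates are `ε`-exactly blind on a balanced colouring column and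
`…StabiliserBlind.lean` rephrased this for row factors invariant under the pointwise stabiliser of a small set; the
missing step "symmetric family of size `< C(m, t+1)` ⟹ each factor is invariant under the EVEN permutations fixing
`≤ t` points" is Yannakakis' lemma (Yannakakis 1991, Claim 2; Kaibel–Pashkovich–Theis 2012, Lemma 12), which the tree
holds as the fully proved Dixon–Mortimer Theorem 5.2B
`Literature.GroupTheory.PermutationGroups.alternating_fixing_le_of_index_lt_choose`. THIS FILE:

* `eq_of_altStabiliserInvariant` — a function on `c`-sets invariant under the even permutations fixing `W` pointwise
  (`#W + 2 ≤ c`) is a junta on `W` (swap two vertices outside `W`, and fix the parity with a second transposition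
  inside the image set);
* `cdist_colorVec_not_altStabInvariantRep` — the `Alt`-version of `cdist_colorVec_not_stabInvariantRep`;
* `cdist_colorVec_not_symmetricRep` (registered stub `symmetric_blind`) — **THEOREM.** Let `h` be a balanced
  `K`-colouring of `Fin m` (`K ≥ 2` classes of size `n ≥ K+1`), `2t ≤ K`, `8 < m`, `4(t+1) ≤ m`. Let `(V_l)_{l ∈ L}`
  be a `Sym(m)`-SYMMETRIC family of functions on vertex sets — every vertex permutation `σ` is compensated by a
  relabelling `τ σ` of the terms, `V_{τ σ l}(σ Q) = V_l(Q)` — non-negative on `(K+1)`-sets, with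
  `#L < C(m, t+1)`. Then for every `ε > 0` and all coefficients `c_l ≥ 0` the identity
  `cdist Q (colorVec h) - ε = ∑_l c_l V_l(Q)` on the `(K+1)`-sets is IMPOSSIBLE.
  (The stabiliser of the term `l` has index `≤ #L < C(m, t+1)` (`XorDoor.exists_stabilizer_index_le`), so by
  Dixon–Mortimer it contains the even permutations fixing some `X_l` with `#X_l ≤ t`; apply the two lemmas above and
  `cdist_colorVec_not_juntaRep`.)

Reading: every `Sym(m)`-symmetric non-negative factorisation of the colouring columns of `D - εJ` — in particular every
Yannakakis-symmetric monotone LP separating `k`-cliques from complete `(k-1)`-partite graphs in the exact sense of the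
crux — has at least `C(m, ⌊(k-1)/2⌋ + 1) = m^{Ω(k)}` terms, for EVERY `ε > 0` (the crux's quantifier order). The PSD
analogue is false (the theta certificate is symmetric of size `m`: `…ColouringTheta.lean`). The asymptotic corollary
in the currency of the canonical form is `…SymmetricHard.lean`. [new; Yannakakis 1991; Kaibel–Pashkovich–Theis 2012]
-/

set_option linter.dupNamespace false

namespace Summit.PneNP.PneNP.Theorems

open Finset Literature.Computability.Complexity
open Summit.PneNP.PneNP.Cruxes.ConvexGateBlind.StrictRankConicCover (cdist)

noncomputable section

variable {m : ℕ}

/-! ## Even permutations outside `W` act transitively on the sets with a given trace on `W` -/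

/-- A permutation mapping a finite set into itself fixes it setwise: `S.map π = S`. [folklore] -/
theorem map_eq_of_mapsTo {π : Equiv.Perm (Fin m)} {S : Finset (Fin m)} (hS : ∀ x ∈ S, π x ∈ S) :
    S.map π.toEmbedding = S :=
  Finset.eq_of_subset_of_card_le
    (fun y hy => by
      obtain ⟨z, hz, rfl⟩ := Finset.mem_map.1 hy
      exact hS z hz)
    (by rw [Finset.card_map])

/-- **Alt-invariant functions are juntas.** If `V` is invariant (on `c`-sets) under every EVEN permutation fixing `W`
pointwise and `#W + 2 ≤ c`, then `V Q = V Q'` for all `c`-sets `Q, Q'` with the same trace on `W`. Proof: as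
`eq_of_stabiliserInvariant`, composing each transposition `(a b)` with a transposition of two vertices of the image set
outside `W` to make the permutation even. [folklore] -/
theorem eq_of_altStabiliserInvariant (V : Finset (Fin m) → ℝ) (W : Finset (Fin m)) {c : ℕ} (hcW : W.card + 2 ≤ c)
    (hV : ∀ σ : Equiv.Perm (Fin m), Equiv.Perm.sign σ = 1 → (∀ w ∈ W, σ w = w) → ∀ Q : Finset (Fin m),
      Q.card = c → V (Q.map σ.toEmbedding) = V Q) :
    ∀ (d : ℕ) (Q Q' : Finset (Fin m)), (Q \ Q').card ≤ d → Q.card = c → Q'.card = c → Q ∩ W = Q' ∩ W →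
      V Q = V Q' := by
  classical
  intro d
  induction d with
  | zero =>
    intro Q Q' hd hQ hQ' _
    have hsub : Q ⊆ Q' := by
      have : Q \ Q' = ∅ := card_eq_zero.1 (Nat.le_zero.1 hd)
      exact sdiff_eq_empty_iff_subset.1 this
    rw [eq_of_subset_of_card_le hsub (by rw [hQ, hQ'])]
  | succ d ih =>
    intro Q Q' hd hQ hQ' hW
    by_cases hzero : (Q \ Q').card = 0
    · exact ih Q Q' (by omega) hQ hQ' hW
    · -- pick `a ∈ Q ∖ Q'` and `b ∈ Q' ∖ Q`; both lie outside `W`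
      obtain ⟨a, ha⟩ : (Q \ Q').Nonempty :=
        nonempty_iff_ne_empty.2 (fun h0 => hzero (by rw [h0, card_empty]))
      have hcard' : (Q' \ Q).card = (Q \ Q').card := by
        have h1 := card_sdiff_add_card_inter Q Q'
        have h2 := card_sdiff_add_card_inter Q' Q
        rw [inter_comm] at h2
        omega
      obtain ⟨b, hb⟩ : (Q' \ Q).Nonempty := by
        rw [← card_pos, hcard']; exact Nat.pos_of_ne_zero hzero
      rw [mem_sdiff] at ha hb
      have haW : a ∉ W := fun haW =>
        ha.2 (mem_of_mem_inter_left (show a ∈ Q' ∩ W from hW ▸ mem_inter.2 ⟨ha.1, haW⟩))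
      have hbW : b ∉ W := fun hbW =>
        hb.2 (mem_of_mem_inter_left (show b ∈ Q ∩ W from hW.symm ▸ mem_inter.2 ⟨hb.1, hbW⟩))
      have hab : a ≠ b := fun h => hb.2 (h ▸ ha.1)
      -- the image set `Q₁ = Q - a + b` and two of its vertices `p ≠ q` outside `W`
      set Q₁ : Finset (Fin m) := insert b (Q.erase a) with hQ₁
      have hQ₁card : Q₁.card = c := by
        rw [hQ₁, card_insert_of_notMem (fun h => hb.2 (mem_of_mem_erase h)), card_erase_of_mem ha.1, hQ]
        have : 0 < c := by rw [← hQ]; exact card_pos.2 ⟨a, ha.1⟩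
        omega
      have htwo : 1 < (Q₁ \ W).card := by
        have := le_card_sdiff W Q₁
        omega
      obtain ⟨p, hp, q, hq, hpq⟩ := one_lt_card.1 htwo
      rw [mem_sdiff] at hp hq
      -- the even permutation `(p q) (a b)` fixes `W` pointwise and maps `Q` to `Q₁`
      set σ : Equiv.Perm (Fin m) := Equiv.swap p q * Equiv.swap a b with hσ
      have hsign : Equiv.Perm.sign σ = 1 := by
        rw [hσ, Equiv.Perm.sign_mul, Equiv.Perm.sign_swap hpq, Equiv.Perm.sign_swap hab]
        decide
      have hfix : ∀ w ∈ W, σ w = w := by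
        intro w hw
        have hwa : w ≠ a := fun h => haW (by rw [h] at hw; exact hw)
        have hwb : w ≠ b := fun h => hbW (by rw [h] at hw; exact hw)
        have hwp : w ≠ p := fun h => hp.2 (by rw [h] at hw; exact hw)
        have hwq : w ≠ q := fun h => hq.2 (by rw [h] at hw; exact hw)
        rw [hσ, Equiv.Perm.mul_apply, Equiv.swap_apply_of_ne_of_ne hwa hwb, Equiv.swap_apply_of_ne_of_ne hwp hwq]
      have hmap : Q.map σ.toEmbedding = Q₁ := by
        have hstep : Q.map (Equiv.swap a b).toEmbedding = Q₁ := by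
          -- the transposition `(a b)` maps `Q` to `Q - a + b` (as `map_swap_eq_insert_erase` of `…StabiliserBlind.lean`)
          rw [hQ₁]
          ext x
          simp only [mem_map_equiv, Equiv.symm_swap, mem_insert, mem_erase]
          constructor
          · intro hx
            by_cases hxb : x = b
            · exact Or.inl hxb
            · right
              have hxa : x ≠ a := by
                rintro rfl
                rw [Equiv.swap_apply_left] at hx
                exact hb.2 hx
              rw [Equiv.swap_apply_of_ne_of_ne hxa hxb] at hx
              exact ⟨hxa, hx⟩
          · rintro (rfl | ⟨hxa, hxQ⟩)
            · rw [Equiv.swap_apply_right]; exact ha.1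
            · have hxb : x ≠ b := fun hxb => hb.2 (hxb ▸ hxQ)
              rw [Equiv.swap_apply_of_ne_of_ne hxa hxb]; exact hxQ
        have hperm : ∀ x ∈ Q₁, Equiv.swap p q x ∈ Q₁ := by
          intro x hx
          by_cases hxp : x = p
          · rw [hxp, Equiv.swap_apply_left]; exact hq.1
          · by_cases hxq : x = q
            · rw [hxq, Equiv.swap_apply_right]; exact hp.1
            · rw [Equiv.swap_apply_of_ne_of_ne hxp hxq]; exact hx
        rw [hσ, Equiv.Perm.mul_def, Equiv.trans_toEmbedding, ← Finset.map_map, hstep]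
        exact map_eq_of_mapsTo hperm
      have hswap : V Q₁ = V Q := by
        rw [← hmap]
        exact hV σ hsign hfix Q hQ
      have hQ₁W : Q₁ ∩ W = Q' ∩ W := by
        rw [← hW, hQ₁]
        ext x
        simp only [mem_inter, mem_insert, mem_erase]
        constructor
        · rintro ⟨rfl | ⟨_, hxQ⟩, hxW⟩
          · exact (hbW hxW).elim
          · exact ⟨hxQ, hxW⟩
        · rintro ⟨hxQ, hxW⟩
          exact ⟨Or.inr ⟨fun h => haW (h ▸ hxW), hxQ⟩, hxW⟩
      have hQ₁diff : (Q₁ \ Q').card ≤ d := by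
        have hsub : Q₁ \ Q' ⊆ (Q \ Q').erase a := by
          intro x hx
          rw [mem_sdiff, hQ₁, mem_insert, mem_erase] at hx
          rcases hx with ⟨rfl | ⟨hxa, hxQ⟩, hxQ'⟩
          · exact (hxQ' hb.1).elim
          · exact mem_erase.2 ⟨hxa, mem_sdiff.2 ⟨hxQ, hxQ'⟩⟩
        have := card_le_card hsub
        rw [card_erase_of_mem (mem_sdiff.2 ha)] at this
        omega
      rw [← hswap]
      exact ih Q₁ Q' hQ₁diff hQ₁card hQ' hQ₁W

/-! ## Alt-stabiliser-invariant certificates are blind -/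

/-- **`Alt`-stabiliser-invariant non-negative certificates are ε-exactly blind on colouring columns.** As
`cdist_colorVec_not_stabInvariantRep`, but each `V_l` need only be invariant (on `(K+1)`-sets) under the EVEN vertex
permutations fixing `W_l` (`#W_l ≤ t`, `2t ≤ K`) pointwise. [new] -/
theorem cdist_colorVec_not_altStabInvariantRep {K : ℕ} (h : Fin m → Fin K) {n t : ℕ}
    (hn : ∀ c, (cls h c).card = n) (hK : 2 ≤ K) (hKn : K + 1 ≤ n) (ht : 2 * t ≤ K) {ε : ℝ} (hε : 0 < ε)
    {ι : Type*} [Fintype ι] (W : ι → Finset (Fin m)) (hW : ∀ l, (W l).card ≤ t) (V : ι → Finset (Fin m) → ℝ)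
    (hV0 : ∀ l Q, Q.card = K + 1 → 0 ≤ V l Q)
    (hV : ∀ l (σ : Equiv.Perm (Fin m)), Equiv.Perm.sign σ = 1 → (∀ w ∈ W l, σ w = w) →
      ∀ Q : Finset (Fin m), Q.card = K + 1 → V l (Q.map σ.toEmbedding) = V l Q) :
    ¬ ∀ Q : Finset (Fin m), Q.card = K + 1 → cdist Q (colorVec h) - ε = ∑ l, V l Q := by
  classical
  intro hrep
  let F : ι → Finset (Fin m) → ℝ := fun l P =>
    if hP : ∃ Q : Finset (Fin m), Q.card = K + 1 ∧ Q ∩ W l = P then V l hP.choose else 0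
  have hF : ∀ l (Q : Finset (Fin m)), Q.card = K + 1 → V l Q = F l (Q ∩ W l) := by
    intro l Q hQ
    have hP : ∃ Q' : Finset (Fin m), Q'.card = K + 1 ∧ Q' ∩ W l = Q ∩ W l := ⟨Q, hQ, rfl⟩
    simp only [F, dif_pos hP]
    have hcW : (W l).card + 2 ≤ K + 1 := by have := hW l; omega
    exact eq_of_altStabiliserInvariant (V l) (W l) hcW (hV l) _ Q hP.choose le_rfl hQ hP.choose_spec.1
      hP.choose_spec.2.symm
  refine cdist_colorVec_not_juntaRep h hn hK hKn ht hε W F hW ?_ ?_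
  · intro l P
    simp only [F]
    split_ifs with hP
    · exact hV0 l _ hP.choose_spec.1
    · exact le_refl _
  · intro Q hQ
    rw [hrep Q hQ]
    exact Finset.sum_congr rfl fun l _ => hF l Q hQ

/-! ## The theorem: symmetric certificates are blind -/

/-- **Symmetric non-negative certificates are ε-exactly blind on colouring columns (unconditional).** Let `h` be a
balanced `K`-colouring of `Fin m` (`K ≥ 2` classes of size `n ≥ K + 1`), `2t ≤ K`, `8 < m`, `4(t+1) ≤ m`; let
`(V_l)_{l ∈ L}` be a `Sym(m)`-symmetric family of functions on vertex sets (`V_{τ σ l}(σ Q) = V_l(Q)`) which are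
non-negative on `(K+1)`-sets, with `#L < C(m, t+1)`. Then for every `ε > 0` and all `c_l ≥ 0` there is NO identity
`cdist Q (colorVec h) - ε = ∑_l c_l V_l(Q)` on the `(K+1)`-sets. (Stabilisers of terms have index `≤ #L`;
Dixon–Mortimer 5.2B makes every `V_l` invariant under the even permutations fixing `≤ t` points; then
`cdist_colorVec_not_altStabInvariantRep`.) [new; Yannakakis 1991, Claim 2] -/
theorem cdist_colorVec_not_symmetricRep {K : ℕ} (h : Fin m → Fin K) {n t : ℕ} (hn : ∀ c, (cls h c).card = n)
    (hK : 2 ≤ K) (hKn : K + 1 ≤ n) (ht : 2 * t ≤ K) (hm8 : 8 < m) (h4t : 4 * (t + 1) ≤ m)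
    {ε : ℝ} (hε : 0 < ε) {L : Type*} [Fintype L] (hL : Fintype.card L < m.choose (t + 1))
    (V : Finset (Fin m) → L → ℝ) (τ : Equiv.Perm (Fin m) → L → L)
    (hτ : ∀ σ l Q, V (Q.map σ.toEmbedding) (τ σ l) = V Q l)
    (hV0 : ∀ l Q, Q.card = K + 1 → 0 ≤ V Q l) (c : L → ℝ) (hc : ∀ l, 0 ≤ c l) :
    ¬ ∀ Q : Finset (Fin m), Q.card = K + 1 → cdist Q (colorVec h) - ε = ∑ l, c l * V Q l := by
  classical
  intro hrep
  -- every term is invariant under the even permutations fixing a small set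
  have hstab : ∀ l, ∃ X : Finset (Fin m), X.card ≤ t ∧ ∀ ρ : Equiv.Perm (Fin m), Equiv.Perm.sign ρ = 1 →
      (∀ x ∈ X, ρ x = x) → ∀ Q : Finset (Fin m), V (Q.map ρ.toEmbedding) l = V Q l := by
    intro l
    obtain ⟨H, hH, hidx⟩ := XorDoor.exists_stabilizer_index_le (G := Equiv.Perm (Fin m))
      (A := Finset (Fin m)) (fun σ Q => Q.map σ.toEmbedding)
      (fun Q => by
        show Q.map (1 : Equiv.Perm (Fin m)).toEmbedding = Q
        rw [Equiv.Perm.one_def, Equiv.refl_toEmbedding, Finset.map_refl])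
      (fun g g' Q => by
        show Q.map (g * g').toEmbedding = (Q.map g'.toEmbedding).map g.toEmbedding
        rw [Equiv.Perm.mul_def, Equiv.trans_toEmbedding, Finset.map_map])
      V τ hτ l
    have hidx' : H.index < (Fintype.card (Fin m)).choose (t + 1) := by
      rw [Fintype.card_fin]; exact lt_of_le_of_lt hidx hL
    obtain ⟨X, hXcard, hX⟩ :=
      Literature.GroupTheory.PermutationGroups.alternating_fixing_le_of_index_lt_choose H (t + 1)
        (by rw [Fintype.card_fin]; exact hm8) (Nat.succ_pos t) (by rw [Fintype.card_fin]; exact h4t) hidx'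
    exact ⟨X, by omega, fun ρ hsign hfix Q => (hH ρ).1 (hX ρ hfix hsign) Q⟩
  choose X hXt hXinv using hstab
  refine cdist_colorVec_not_altStabInvariantRep h hn hK hKn ht hε X hXt (fun l Q => c l * V Q l) ?_ ?_ ?_
  · intro l Q hQ
    exact mul_nonneg (hc l) (hV0 l Q hQ)
  · intro l σ hsign hfix Q _
    show c l * V (Q.map σ.toEmbedding) l = c l * V Q l
    rw [hXinv l σ hsign hfix Q]
  · intro Q hQ
    rw [hrep Q hQ]

/-- **Registered helper stub (symmetric certificates are blind).** Restatement of `cdist_colorVec_not_symmetricRep`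
with all parameters explicit. -/
theorem symmetric_blind : ∀ {m K n t : ℕ} (h : Fin m → Fin K), (∀ c, (cls h c).card = n) → 2 ≤ K → K + 1 ≤ n → 2 * t ≤ K → 8 < m → 4 * (t + 1) ≤ m → ∀ (ε : ℝ), 0 < ε → ∀ {L : Type} [Fintype L], Fintype.card L < m.choose (t + 1) → ∀ (V : Finset (Fin m) → L → ℝ) (τ : Equiv.Perm (Fin m) → L → L), (∀ σ l Q, V (Q.map σ.toEmbedding) (τ σ l) = V Q l) → (∀ l Q, Q.card = K + 1 → 0 ≤ V Q l) → ∀ (c : L → ℝ), (∀ l, 0 ≤ c l) → ¬ ∀ Q : Finset (Fin m), Q.card = K + 1 → cdist Q (colorVec h) - ε = ∑ l, c l * V Q l := by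
  intro m K n t h hn hK hKn ht hm8 h4t ε hε L _ hL V τ hτ hV0 c hc
  exact cdist_colorVec_not_symmetricRep h hn hK hKn ht hm8 h4t hε hL V τ hτ hV0 c hc

end

end Summit.PneNP.PneNP.Theorems
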